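import Literature.AlgebraicGeometry.Resolution.CentreBlowupAdaptedOrder
import Literature.AlgebraicGeometry.Resolution.PointBlowupKangaroo
import Mathlib.Algebra.MvPolynomial.PDeriv
import HarnessLib

/-!
# [Cossart–Piltant 2019, Remark 3.2]: the numbers of the published counterexample, computed in the model

`CentreBlowupAdaptedOrder` types Cossart–Piltant's numbers `ε(x)`, `ω(x)`, `ε(y)` and the centre
predicates (Hironaka-permissible, permissible of the first / second kind, clause (iii)) at a
coordinate centre `C_S` of the coordinate-centre walk, and records the STATE of the counterexample of
[Cossart–Piltant 2019, Remark 3.2 (p. 41)] as `cp19Remark32` (with the two centres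
`cp19Remark32Centre`, `cp19Remark32Curve`).  This file carries out, for every exponent `p > 1` and
over any field `K`, the computation printed in the Remark, in those definitions:

"Remark 3.2. The conclusion of the above theorem fails in general if it is only assumed that
`𝒴₀ ⊂ 𝒴₁` is such that `𝒴₀` is permissible at `x`, `𝒴₁` Hironaka-permissible at `x` w.r.t. `E`.
A counterexample with `n = 4` is given for `char S = p > 0` by taking:
`h = Z^p + u₄u₁^p + u₃u₂^p`, `E = div(u₁u₂u₃)`, `Sing_p 𝒳 = V(Z,u₁,u₂)`. Then `(u₁,…,u₄;Z)` are well
adapted coordinates. Taking `𝒴₀ = V(Z,u₁,u₂) ⊂ 𝒴₁ = V(Z,u₁,u₂,u₄) ⊂ {x} = V(Z,u₁,u₂,u₃,u₄)`, we have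
`ε(y₀) = ε(y₁) = ε(x) − 1 = ω(x) = p`. Note that `𝒴₁` does not satisfy definition 3.2 (iii). There
is a unique point `x' = (Z',u'₁,u'₂,u₃,u'₄) := (Z/u₄, u₁/u₄, u₂/u₄, u₃, u₄) ∈ 𝒴'₀ = V(Z',u'₁,u'₂)`.
A local equation for the strict transform `𝒳'` of `𝒳` at `x` is:
`h' = Z'^p + u'₄u'₁^p + u₃u'₂^p`, `E' = div(u'₁u'₂u₃u'₄)`. Thus `ε(x') = ω(x') = p + 1 > ω(x)` and
`𝒴'₀` is not permissible at `x'` since `ε(y₀) = p < ε(x')`."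

Dictionary (as in `CentreBlowupAdaptedOrder` §4): variables `0,1,2,3` are `u₁,u₂,u₃,u₄`;
`F = u₄u₁^p + u₃u₂^p = y^{d_A} + y^{d_B}` with `d_A = e₃ + p·e₀ = Finsupp.single 3 1 + Finsupp.single 0 p`,
`d_B = e₂ + p·e₁ = Finsupp.single 2 1 + Finsupp.single 1 p`; `exc = {0,1,2}`; `S₁ = cp19Remark32Centre = {0,1,3}`
(`𝒴₁`), `S₀ = cp19Remark32Curve = {0,1}` (`𝒴₀`); the point `x'` is the origin `b = 0` of the
`u₄`-chart (`j = 3`) of the blow-up of `C_{S₁}` (`CentreBlowup.step p S₁ 3 0`).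

* §1 the state `x`: `ord₀ F = p + 1`, `H_j = 0` for every `j`, `ε(x) = p + 1`, `F_{p,Z} = F`,
  `∂F_{p,Z}/∂u₄ = u₁^p ≠ 0` with `u₄ ∉ E`, so `V ≠ 0` and `ω(x) = ε(x) − 1 = p`;
* §2 the centre `𝒴₁`: `ord_{C_{S₁}} F = p`, `ε(y₁) = p = ε(x) − 1 = ω(x)` (clause (ii) of Def. 3.2
  holds), `𝒴₁` is Hironaka-permissible, clause (iii) FAILS (the only variable off `S₁` is `u₃`, and
  `div(u₃) ⊆ E`), so `𝒴₁` is permissible of neither kind; the curve `𝒴₀`: `ε(y₀) = p` and `𝒴₀` IS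
  permissible of the second kind (witness the monomial `u₄u₁^p`, `div(u₄) ⊄ E`);
* §3 the blow-up of `𝒴₁` at `x'`: the chart law fixes both exponents, so `h'` has the same residual
  polynomial ("`h' = Z'^p + u'₄u'₁^p + u₃u'₂^p`"), `E'` = all four variables ("`div(u'₁u'₂u₃u'₄)`"),
  `ε(x') = p + 1`, `V' = 0` (no variable off `E'`), `ω(x') = ε(x') = p + 1 > p = ω(x)`: the edge
  predicate `OmegaIncreases` holds while `EpsilonIncreases` fails; `x'` is again `p`-fold
  (`IsEquimultiplePoint`); and `𝒴'₀` is not permissible at `x'`;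
* §4 packaging: every hypothesis of the test predicate `NoOmegaIncreaseAtCentre` of
  `CentreBlowupAdaptedOrder` holds at `(𝒴₁, x')` EXCEPT `IsPermissibleCentre` — of which exactly
  clause (iii) fails — and its conclusion fails (`cp19Remark32_sharpness`): clause (iii) cannot be
  dropped; the predicate itself holds at this edge, vacuously (`cp19Remark32_noOmegaIncreaseAtCentre`).

This is the `ε / ω` side of the Remark.  The coordinate-substitution identity
`h(u₄Z', u₄u'₁, u₄u'₂, u₃, u₄) = u₄^p · h'` over any commutative ring is already
`Literature.Barriers.ResolutionOfSingularities.bind₁_cpRemark32Poly` (`DimensionFourFrontier`).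
Nothing beyond the printed computation is asserted — in particular nothing about `κ`, condition (E),
well adapted coordinates after the blow-up, or the behaviour of `ι = (m, ω, κ)` in dimension four.
AI-assisted formalisation (observatory `pub-rosobs`, unit `pub-rosobs-carver-g25`); the quotation is
from arXiv:1412.0868 (PDF page 41).
-/

noncomputable section

open MvPolynomial Finset

open scoped BigOperators

namespace Literature.AlgebraicGeometry.Resolution

open Literature.AlgebraicGeometry.Resolution.Hauser2010
open Literature.AlgebraicGeometry.Resolution.HauserPerlega2019 (initialForm)

namespace CentreBlowup

/-! ### 0. Two folklore helpers (private) -/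

section Helpers

variable {σ : Type*} {K : Type*}

/-- The `C_S`-chart transform of `y^{d₁} + y^{d₂}` (`d₁ ≠ d₂`) is `y^{χ d₁} + y^{χ d₂}`,
`χ = chartExponent q S j` (the coordinate-centre version of `PointBlowup.chartTransform_binomial`).
[folklore] -/
private theorem chartTransform_binomial [DecidableEq σ] [Field K] (q : ℕ) (S : Finset σ) (j : σ)
    {d₁ d₂ : σ →₀ ℕ} (h : d₁ ≠ d₂) :
    chartTransform q S j (monomial d₁ (1 : K) + monomial d₂ 1) =
      monomial (chartExponent q S j d₁) 1 + monomial (chartExponent q S j d₂) 1 := by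
  unfold chartTransform
  rw [PointBlowup.support_binomial h, Finset.sum_pair h, coeff_add, coeff_add, coeff_monomial,
    coeff_monomial, coeff_monomial, coeff_monomial, if_pos rfl, if_pos rfl, if_neg h,
    if_neg (Ne.symm h), add_zero, zero_add]

/-- `H_j ≤ d_j` for every monomial `y^d` of `F` (`H_j = min {d_j : d ∈ supp F}`). [folklore] -/
private theorem bigH_le_apply [CommRing K] {F : MvPolynomial σ K} {d : σ →₀ ℕ} (hd : d ∈ F.support)
    (j : σ) : PointBlowup.bigH F j ≤ d j :=
  Finset.inf_le (f := fun d : σ →₀ ℕ => ((d j : ℕ) : ℕ∞)) hd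

end Helpers

/-! ### 1. The state `x`: `h = Z^p + u₄u₁^p + u₃u₂^p`, `E = div(u₁u₂u₃)` -/

section State

variable {K : Type*} [Field K]

/- Exponents (no new definitions are introduced; the two exponent vectors are written out):
`d_A = e₃ + p·e₀ = Finsupp.single 3 1 + Finsupp.single 0 p` (the monomial `u₄u₁^p`),
`d_B = e₂ + p·e₁ = Finsupp.single 2 1 + Finsupp.single 1 p` (the monomial `u₃u₂^p`). -/

/-- `(d_A)_{u₁} = p`. [cite: CossartPiltant2019, Remark 3.2 (p. 41)] -/
theorem cp19Remark32ExpA_zero (p : ℕ) : (Finsupp.single 3 1 + Finsupp.single 0 p : Fin 4 →₀ ℕ) 0 = p := by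
  simp

/-- `(d_A)_{u₂} = 0`. [cite: CossartPiltant2019, Remark 3.2 (p. 41)] -/
theorem cp19Remark32ExpA_one (p : ℕ) : (Finsupp.single 3 1 + Finsupp.single 0 p : Fin 4 →₀ ℕ) 1 = 0 := by
  simp

/-- `(d_A)_{u₃} = 0`. [cite: CossartPiltant2019, Remark 3.2 (p. 41)] -/
theorem cp19Remark32ExpA_two (p : ℕ) : (Finsupp.single 3 1 + Finsupp.single 0 p : Fin 4 →₀ ℕ) 2 = 0 := by
  simp

/-- `(d_A)_{u₄} = 1`. [cite: CossartPiltant2019, Remark 3.2 (p. 41)] -/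
theorem cp19Remark32ExpA_three (p : ℕ) : (Finsupp.single 3 1 + Finsupp.single 0 p : Fin 4 →₀ ℕ) 3 = 1 := by
  simp

/-- `(d_B)_{u₁} = 0`. [cite: CossartPiltant2019, Remark 3.2 (p. 41)] -/
theorem cp19Remark32ExpB_zero (p : ℕ) : (Finsupp.single 2 1 + Finsupp.single 1 p : Fin 4 →₀ ℕ) 0 = 0 := by
  simp

/-- `(d_B)_{u₂} = p`. [cite: CossartPiltant2019, Remark 3.2 (p. 41)] -/
theorem cp19Remark32ExpB_one (p : ℕ) : (Finsupp.single 2 1 + Finsupp.single 1 p : Fin 4 →₀ ℕ) 1 = p := by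
  simp

/-- `(d_B)_{u₃} = 1`. [cite: CossartPiltant2019, Remark 3.2 (p. 41)] -/
theorem cp19Remark32ExpB_two (p : ℕ) : (Finsupp.single 2 1 + Finsupp.single 1 p : Fin 4 →₀ ℕ) 2 = 1 := by
  simp

/-- `(d_B)_{u₄} = 0`. [cite: CossartPiltant2019, Remark 3.2 (p. 41)] -/
theorem cp19Remark32ExpB_three (p : ℕ) : (Finsupp.single 2 1 + Finsupp.single 1 p : Fin 4 →₀ ℕ) 3 = 0 := by
  simp

/-- `d_A ≠ d_B`. [cite: CossartPiltant2019, Remark 3.2 (p. 41)] -/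
theorem cp19Remark32ExpA_ne_ExpB (p : ℕ) :
    (Finsupp.single 3 1 + Finsupp.single 0 p : Fin 4 →₀ ℕ) ≠ Finsupp.single 2 1 + Finsupp.single 1 p := by
  intro h
  have h3 := DFunLike.congr_fun h 3
  rw [cp19Remark32ExpA_three, cp19Remark32ExpB_three] at h3
  exact one_ne_zero h3

/-- `|d_A| = p + 1`. [cite: CossartPiltant2019, Remark 3.2 (p. 41)] -/
theorem degree_cp19Remark32ExpA (p : ℕ) :
    (Finsupp.single 3 1 + Finsupp.single 0 p : Fin 4 →₀ ℕ).degree = p + 1 := by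
  rw [map_add, Finsupp.degree_single, Finsupp.degree_single, add_comm]

/-- `|d_B| = p + 1`. [cite: CossartPiltant2019, Remark 3.2 (p. 41)] -/
theorem degree_cp19Remark32ExpB (p : ℕ) :
    (Finsupp.single 2 1 + Finsupp.single 1 p : Fin 4 →₀ ℕ).degree = p + 1 := by
  rw [map_add, Finsupp.degree_single, Finsupp.degree_single, add_comm]

/-- `F = h − Z^p = y^{d_A} + y^{d_B}` as a sum of two monomials with unit coefficients.
[cite: CossartPiltant2019, Remark 3.2 (p. 41)] -/
theorem cp19Remark32_F (p : ℕ) :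
    (cp19Remark32 p : CState (Fin 4) K).F =
      monomial (Finsupp.single 3 1 + Finsupp.single 0 p) 1 +
        monomial (Finsupp.single 2 1 + Finsupp.single 1 p) 1 := by
  show (X 3 * X 0 ^ p + X 2 * X 1 ^ p : MvPolynomial (Fin 4) K) = _
  have h3 : (X 3 : MvPolynomial (Fin 4) K) = monomial (Finsupp.single 3 1) 1 := rfl
  have h2 : (X 2 : MvPolynomial (Fin 4) K) = monomial (Finsupp.single 2 1) 1 := rfl
  rw [h3, h2, X_pow_eq_monomial, X_pow_eq_monomial, monomial_mul, monomial_mul, mul_one]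

/-- `supp F = {d_A, d_B}`. [cite: CossartPiltant2019, Remark 3.2 (p. 41)] -/
theorem cp19Remark32_support (p : ℕ) :
    (cp19Remark32 p : CState (Fin 4) K).F.support =
      {Finsupp.single 3 1 + Finsupp.single 0 p, Finsupp.single 2 1 + Finsupp.single 1 p} := by
  rw [cp19Remark32_F, PointBlowup.support_binomial (cp19Remark32ExpA_ne_ExpB p)]

/-- `ord₀ F = p + 1` (`m(x) = p`, `p δ(x) = p + 1`). [cite: CossartPiltant2019, Remark 3.2 (p. 41)] -/
theorem cp19Remark32_ordZero (p : ℕ) :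
    ordZero (cp19Remark32 p : CState (Fin 4) K).F = (p + 1 : ℕ) := by
  rw [cp19Remark32_F, PointBlowup.ordZero_binomial (cp19Remark32ExpA_ne_ExpB p)
    ((degree_cp19Remark32ExpB p).trans_le (degree_cp19Remark32ExpA p).ge), degree_cp19Remark32ExpB]

/-- `H_j = 0` for every `j` (`E = div(u₁u₂u₃)`, and `H(x) = 1`: no `u_j` divides `F`).
[cite: CossartPiltant2019, Remark 3.2 (p. 41)] -/
theorem cp19Remark32_bigH (p : ℕ) (j : Fin 4) :
    PointBlowup.bigH (cp19Remark32 p : CState (Fin 4) K).F j = 0 := by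
  have hj : (j = 1 ∨ j = 2) ∨ (j = 0 ∨ j = 3) := by revert j; decide
  have hA : (Finsupp.single 3 1 + Finsupp.single 0 p : Fin 4 →₀ ℕ) ∈
      (cp19Remark32 p : CState (Fin 4) K).F.support := by
    rw [cp19Remark32_support]; exact Finset.mem_insert_self _ _
  have hB : (Finsupp.single 2 1 + Finsupp.single 1 p : Fin 4 →₀ ℕ) ∈
      (cp19Remark32 p : CState (Fin 4) K).F.support := by
    rw [cp19Remark32_support]; exact Finset.mem_insert_of_mem (Finset.mem_singleton_self _)
  have hA' := bigH_le_apply hA j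
  have hB' := bigH_le_apply hB j
  rcases hj with (rfl | rfl) | (rfl | rfl)
  · rw [cp19Remark32ExpA_one, Nat.cast_zero] at hA'; exact nonpos_iff_eq_zero.mp hA'
  · rw [cp19Remark32ExpA_two, Nat.cast_zero] at hA'; exact nonpos_iff_eq_zero.mp hA'
  · rw [cp19Remark32ExpB_zero, Nat.cast_zero] at hB'; exact nonpos_iff_eq_zero.mp hB'
  · rw [cp19Remark32ExpB_three, Nat.cast_zero] at hB'; exact nonpos_iff_eq_zero.mp hB'

/-- `ε(x) = p + 1` ("`ε(x) − 1 = ω(x) = p`"). [cite: CossartPiltant2019, Remark 3.2 (p. 41)] -/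
theorem cp19Remark32_epsilon (p : ℕ) :
    (cp19Remark32 p : CState (Fin 4) K).epsilon = (p + 1 : ℕ) := by
  rw [CState.epsilon_eq, Finset.sum_eq_zero (fun j _ => cp19Remark32_bigH p j), tsub_zero,
    cp19Remark32_ordZero]

/-- `F` is a form of degree `p + 1`. [cite: CossartPiltant2019, Remark 3.2 (p. 41)] -/
theorem cp19Remark32_isHomogeneous (p : ℕ) :
    ((cp19Remark32 p : CState (Fin 4) K).F).IsHomogeneous (p + 1) := by
  rw [cp19Remark32_F]
  exact (isHomogeneous_monomial _ (degree_cp19Remark32ExpA p)).add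
    (isHomogeneous_monomial _ (degree_cp19Remark32ExpB p))

/-- `F_{p,Z} = F` (the initial form of `h` is `Z^p + F`, `F` being a form).
[cite: CossartPiltant2019, Remark 3.2 (p. 41)] -/
theorem cp19Remark32_initialForm (p : ℕ) :
    initialForm (cp19Remark32 p : CState (Fin 4) K).F = (cp19Remark32 p : CState (Fin 4) K).F := by
  unfold HauserPerlega2019.initialForm
  rw [cp19Remark32_ordZero, ENat.toNat_coe]
  exact homogeneousComponent_eq_self (cp19Remark32_isHomogeneous p)

/-- `∂F_{p,Z}/∂u₄ = u₁^p`. [cite: CossartPiltant2019, Remark 3.2 (p. 41)] -/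
theorem cp19Remark32_pderiv (p : ℕ) :
    pderiv 3 (initialForm (cp19Remark32 p : CState (Fin 4) K).F) = X 0 ^ p := by
  have hA : (Finsupp.single 3 1 + Finsupp.single 0 p : Fin 4 →₀ ℕ) - Finsupp.single 3 1 =
      Finsupp.single 0 p := add_tsub_cancel_left _ _
  rw [cp19Remark32_initialForm, cp19Remark32_F, map_add, pderiv_monomial, pderiv_monomial,
    cp19Remark32ExpA_three, cp19Remark32ExpB_three, Nat.cast_one, mul_one, Nat.cast_zero, mul_zero,
    monomial_zero, add_zero, hA, X_pow_eq_monomial]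

/-- `∂F_{p,Z}/∂u₄ ≠ 0`. [cite: CossartPiltant2019, Remark 3.2 (p. 41)] -/
theorem cp19Remark32_pderiv_ne_zero (p : ℕ) :
    pderiv 3 (initialForm (cp19Remark32 p : CState (Fin 4) K).F) ≠ 0 := by
  rw [cp19Remark32_pderiv, X_pow_eq_monomial, Ne, monomial_eq_zero]
  exact one_ne_zero

/-- `V(F_{p,Z}, E, m_S) ≠ 0`: `u₄ ∉ E` and `∂F_{p,Z}/∂u₄ ≠ 0`. [cite: CossartPiltant2019, Remark 3.2 (p. 41)] -/
theorem cp19Remark32_vNonzero (p : ℕ) :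
    PointBlowup.VNonzero (cp19Remark32 p : CState (Fin 4) K).exc (cp19Remark32 p : CState (Fin 4) K).F :=
  ⟨3, (show (3 : Fin 4) ∉ ({0, 1, 2} : Finset (Fin 4)) by decide), cp19Remark32_pderiv_ne_zero p⟩

/-- `ω(x) = p` (`ω(x) = ε(x) − 1` since `V ≠ 0`). [cite: CossartPiltant2019, Remark 3.2 (p. 41)] -/
theorem cp19Remark32_omega (p : ℕ) : (cp19Remark32 p : CState (Fin 4) K).omega = p := by
  rw [CState.omega_eq_of_vNonzero _ (cp19Remark32_vNonzero p), cp19Remark32_epsilon, ← ENat.coe_one,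
    ← ENat.coe_sub, Nat.add_sub_cancel]

/-- `ω(x) > 0` (for `p > 0`). [cite: CossartPiltant2019, Remark 3.2 (p. 41)] -/
theorem cp19Remark32_omega_pos {p : ℕ} (hp : 0 < p) : 0 < (cp19Remark32 p : CState (Fin 4) K).omega := by
  rw [cp19Remark32_omega]
  exact_mod_cast hp

/-- `ω(x)` is finite. [cite: CossartPiltant2019, Remark 3.2 (p. 41)] -/
theorem cp19Remark32_omega_ne_top (p : ℕ) : (cp19Remark32 p : CState (Fin 4) K).omega ≠ ⊤ := by
  rw [cp19Remark32_omega]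
  exact ENat.coe_ne_top p

/-! ### 2. The centres `𝒴₁ = V(Z,u₁,u₂,u₄)` and `𝒴₀ = V(Z,u₁,u₂)` -/

/-- `Σ_{i ∈ S₁} dᵢ = d₀ + d₁ + d₃`. [cite: CossartPiltant2019, Remark 3.2 (p. 41)] -/
theorem degIn_cp19Remark32Centre (d : Fin 4 →₀ ℕ) : degIn cp19Remark32Centre d = d 0 + d 1 + d 3 := by
  rw [degIn, cp19Remark32Centre,
    Finset.sum_insert (show (0 : Fin 4) ∉ ({1, 3} : Finset (Fin 4)) by decide),
    Finset.sum_insert (show (1 : Fin 4) ∉ ({3} : Finset (Fin 4)) by decide), Finset.sum_singleton,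
    ← add_assoc]

/-- `Σ_{i ∈ S₀} dᵢ = d₀ + d₁`. [cite: CossartPiltant2019, Remark 3.2 (p. 41)] -/
theorem degIn_cp19Remark32Curve (d : Fin 4 →₀ ℕ) : degIn cp19Remark32Curve d = d 0 + d 1 := by
  rw [degIn, cp19Remark32Curve, Finset.sum_pair (show (0 : Fin 4) ≠ 1 by decide)]

/-- `ord_{S₁}(u₄u₁^p) = p + 1`. [cite: CossartPiltant2019, Remark 3.2 (p. 41)] -/
theorem degIn_centre_cp19Remark32ExpA (p : ℕ) :
    degIn cp19Remark32Centre (Finsupp.single 3 1 + Finsupp.single 0 p) = p + 1 := by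
  have h := degIn_cp19Remark32Centre (Finsupp.single 3 1 + Finsupp.single 0 p)
  rw [cp19Remark32ExpA_zero, cp19Remark32ExpA_one, cp19Remark32ExpA_three] at h
  omega

/-- `ord_{S₁}(u₃u₂^p) = p`. [cite: CossartPiltant2019, Remark 3.2 (p. 41)] -/
theorem degIn_centre_cp19Remark32ExpB (p : ℕ) :
    degIn cp19Remark32Centre (Finsupp.single 2 1 + Finsupp.single 1 p) = p := by
  have h := degIn_cp19Remark32Centre (Finsupp.single 2 1 + Finsupp.single 1 p)
  rw [cp19Remark32ExpB_zero, cp19Remark32ExpB_one, cp19Remark32ExpB_three] at h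
  omega

/-- `ord_{S₀}(u₄u₁^p) = p`. [cite: CossartPiltant2019, Remark 3.2 (p. 41)] -/
theorem degIn_curve_cp19Remark32ExpA (p : ℕ) :
    degIn cp19Remark32Curve (Finsupp.single 3 1 + Finsupp.single 0 p) = p := by
  have h := degIn_cp19Remark32Curve (Finsupp.single 3 1 + Finsupp.single 0 p)
  rw [cp19Remark32ExpA_zero, cp19Remark32ExpA_one] at h
  omega

/-- `ord_{S₀}(u₃u₂^p) = p`. [cite: CossartPiltant2019, Remark 3.2 (p. 41)] -/
theorem degIn_curve_cp19Remark32ExpB (p : ℕ) :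
    degIn cp19Remark32Curve (Finsupp.single 2 1 + Finsupp.single 1 p) = p := by
  have h := degIn_cp19Remark32Curve (Finsupp.single 2 1 + Finsupp.single 1 p)
  rw [cp19Remark32ExpB_zero, cp19Remark32ExpB_one] at h
  omega

/-- `ord_{C_{S₁}} F = p` (`p δ(y₁)`). [cite: CossartPiltant2019, Remark 3.2 (p. 41)] -/
theorem cp19Remark32_ordAlong_centre (p : ℕ) :
    ordAlong cp19Remark32Centre (cp19Remark32 p : CState (Fin 4) K).F = p := by
  unfold ordAlong
  rw [cp19Remark32_support, Finset.inf_insert, Finset.inf_singleton, degIn_centre_cp19Remark32ExpA,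
    degIn_centre_cp19Remark32ExpB]
  exact inf_eq_right.mpr (by exact_mod_cast Nat.le_succ p)

/-- `ord_{C_{S₀}} F = p` (`p δ(y₀)`). [cite: CossartPiltant2019, Remark 3.2 (p. 41)] -/
theorem cp19Remark32_ordAlong_curve (p : ℕ) :
    ordAlong cp19Remark32Curve (cp19Remark32 p : CState (Fin 4) K).F = p := by
  unfold ordAlong
  rw [cp19Remark32_support, Finset.inf_insert, Finset.inf_singleton, degIn_curve_cp19Remark32ExpA,
    degIn_curve_cp19Remark32ExpB, inf_idem]

/-- "`ε(y₁) = p`". [cite: CossartPiltant2019, Remark 3.2 (p. 41)] -/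
theorem cp19Remark32_epsilonAlong_centre (p : ℕ) :
    epsilonAlong cp19Remark32Centre (cp19Remark32 p : CState (Fin 4) K) = p := by
  unfold epsilonAlong
  rw [Finset.sum_eq_zero (fun j _ => cp19Remark32_bigH p j), tsub_zero, cp19Remark32_ordAlong_centre]

/-- "`ε(y₀) = p`". [cite: CossartPiltant2019, Remark 3.2 (p. 41)] -/
theorem cp19Remark32_epsilonAlong_curve (p : ℕ) :
    epsilonAlong cp19Remark32Curve (cp19Remark32 p : CState (Fin 4) K) = p := by
  unfold epsilonAlong
  rw [Finset.sum_eq_zero (fun j _ => cp19Remark32_bigH p j), tsub_zero, cp19Remark32_ordAlong_curve]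

/-- "`ε(y₀) = ε(y₁)`". [cite: CossartPiltant2019, Remark 3.2 (p. 41)] -/
theorem cp19Remark32_epsilonAlong_curve_eq_centre (p : ℕ) :
    epsilonAlong cp19Remark32Curve (cp19Remark32 p : CState (Fin 4) K) =
      epsilonAlong cp19Remark32Centre (cp19Remark32 p : CState (Fin 4) K) := by
  rw [cp19Remark32_epsilonAlong_curve, cp19Remark32_epsilonAlong_centre]

/-- "`ε(y₁) = ε(x) − 1`": clause (ii) of Def. 3.2 holds for `𝒴₁` (written `ε(y₁) + 1 = ε(x)`).
[cite: CossartPiltant2019, Remark 3.2 (p. 41)] -/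
theorem cp19Remark32_epsilonAlong_centre_add_one (p : ℕ) :
    epsilonAlong cp19Remark32Centre (cp19Remark32 p : CState (Fin 4) K) + 1 =
      (cp19Remark32 p : CState (Fin 4) K).epsilon := by
  rw [cp19Remark32_epsilonAlong_centre, cp19Remark32_epsilon, Nat.cast_add_one]

/-- "`ε(y₁) = … = ω(x)`". [cite: CossartPiltant2019, Remark 3.2 (p. 41)] -/
theorem cp19Remark32_epsilonAlong_centre_eq_omega (p : ℕ) :
    epsilonAlong cp19Remark32Centre (cp19Remark32 p : CState (Fin 4) K) =
      (cp19Remark32 p : CState (Fin 4) K).omega := by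
  rw [cp19Remark32_epsilonAlong_centre, cp19Remark32_omega]

/-- `𝒴₁` is Hironaka-permissible at `x` w.r.t. `E` (`C_{S₁} ⊆ Sing_p`: `p ≤ ord_{C_{S₁}} F`).
[cite: CossartPiltant2019, Remark 3.2 (p. 41)] -/
theorem cp19Remark32_isHironakaPermissible_centre (p : ℕ) :
    IsHironakaPermissible p cp19Remark32Centre (cp19Remark32 p : CState (Fin 4) K) :=
  ⟨⟨0, by decide⟩, (cp19Remark32_ordAlong_centre p).ge⟩

/-- `𝒴₀` is Hironaka-permissible at `x` w.r.t. `E`. [cite: CossartPiltant2019, Remark 3.2 (p. 41)] -/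
theorem cp19Remark32_isHironakaPermissible_curve (p : ℕ) :
    IsHironakaPermissible p cp19Remark32Curve (cp19Remark32 p : CState (Fin 4) K) :=
  ⟨⟨0, by decide⟩, (cp19Remark32_ordAlong_curve p).ge⟩

/-- Every variable off `S₁` is a component of `E`: `J' = {u₃}` and `div(u₃) ⊆ E`, i.e.
`J' ∖ (J')_E = ∅`. [cite: CossartPiltant2019, Remark 3.2 (p. 41)] -/
theorem cp19Remark32_mem_centre_or_exc (p : ℕ) (t : Fin 4) :
    t ∈ cp19Remark32Centre ∨ t ∈ (cp19Remark32 p : CState (Fin 4) K).exc := by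
  have h : ∀ u : Fin 4, u ∈ cp19Remark32Centre ∨ u ∈ ({0, 1, 2} : Finset (Fin 4)) := by decide
  exact h t

/-- "Note that `𝒴₁` does not satisfy definition 3.2 (iii)." [cite: CossartPiltant2019, Remark 3.2 (p. 41)] -/
theorem cp19Remark32_not_hasTransverseLinear_centre (p : ℕ) :
    ¬ HasTransverseLinear cp19Remark32Centre (cp19Remark32 p : CState (Fin 4) K) := by
  rintro ⟨d, -, -, t, htS, htE, -, -⟩
  exact (cp19Remark32_mem_centre_or_exc (K := K) p t).elim htS htE

/-- `𝒴₁` is not permissible of the first kind (`ε(y₁) = p ≠ p + 1 = ε(x)`).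
[cite: CossartPiltant2019, Remark 3.2 (p. 41)] -/
theorem cp19Remark32_not_isFirstKind_centre (p : ℕ) :
    ¬ IsFirstKind p cp19Remark32Centre (cp19Remark32 p : CState (Fin 4) K) := by
  rintro ⟨-, h⟩
  rw [cp19Remark32_epsilonAlong_centre, cp19Remark32_epsilon] at h
  have := ENat.coe_inj.mp h
  omega

/-- `𝒴₁` is not permissible of the second kind ((i), (ii) hold, (iii) fails).
[cite: CossartPiltant2019, Remark 3.2 (p. 41)] -/
theorem cp19Remark32_not_isSecondKind_centre (p : ℕ) :
    ¬ IsSecondKind p cp19Remark32Centre (cp19Remark32 p : CState (Fin 4) K) :=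
  fun h => cp19Remark32_not_hasTransverseLinear_centre p h.2.2

/-- `𝒴₁` is a permissible centre of neither kind at `x` (though Hironaka-permissible w.r.t. `E`).
[cite: CossartPiltant2019, Remark 3.2 (p. 41)] -/
theorem cp19Remark32_not_isPermissibleCentre_centre (p : ℕ) :
    ¬ IsPermissibleCentre p cp19Remark32Centre (cp19Remark32 p : CState (Fin 4) K) := by
  rintro (h | h)
  · exact cp19Remark32_not_isFirstKind_centre p h
  · exact cp19Remark32_not_isSecondKind_centre p h

/-- Clause (iii) holds for the curve `𝒴₀`: the monomial `u₄u₁^p` has least `S₀`-degree `p`, is linear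
in `u₄` and free of `u₃`, and `div(u₄) ⊄ E`. [cite: CossartPiltant2019, Remark 3.2 (p. 41)] -/
theorem cp19Remark32_hasTransverseLinear_curve (p : ℕ) :
    HasTransverseLinear cp19Remark32Curve (cp19Remark32 p : CState (Fin 4) K) := by
  refine ⟨Finsupp.single 3 1 + Finsupp.single 0 p, ?_, ?_, 3, by decide,
    (show (3 : Fin 4) ∉ ({0, 1, 2} : Finset (Fin 4)) by decide), cp19Remark32ExpA_three p, ?_⟩
  · rw [cp19Remark32_support]; exact Finset.mem_insert_self _ _
  · rw [cp19Remark32_ordAlong_curve, degIn_curve_cp19Remark32ExpA]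
  · intro u hu hne
    have hu' : ∀ v : Fin 4, v ∉ cp19Remark32Curve → v ≠ 3 → v = 2 := by decide
    rw [hu' u hu hne, cp19Remark32ExpA_two]

/-- "`𝒴₀` is permissible at `x`" — of the second kind: (i) Hironaka-permissible, (ii)
`ε(y₀) + 1 = ε(x)`, (iii). (The Remark's last sentence: "such counterexamples exist only for `𝒴₀` of
the second kind and `n ≥ 4`".) [cite: CossartPiltant2019, Remark 3.2 (p. 41)] -/
theorem cp19Remark32_isSecondKind_curve (p : ℕ) :
    IsSecondKind p cp19Remark32Curve (cp19Remark32 p : CState (Fin 4) K) := by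
  refine ⟨cp19Remark32_isHironakaPermissible_curve p, ?_, cp19Remark32_hasTransverseLinear_curve p⟩
  rw [cp19Remark32_epsilonAlong_curve, cp19Remark32_epsilon, Nat.cast_add_one]

/-- `𝒴₀` is not of the first kind (`ε(y₀) = p < ε(x)`). [cite: CossartPiltant2019, Remark 3.2 (p. 41)] -/
theorem cp19Remark32_not_isFirstKind_curve (p : ℕ) :
    ¬ IsFirstKind p cp19Remark32Curve (cp19Remark32 p : CState (Fin 4) K) := by
  rintro ⟨-, h⟩
  rw [cp19Remark32_epsilonAlong_curve, cp19Remark32_epsilon] at h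
  have := ENat.coe_inj.mp h
  omega

/-- `𝒴₀` is a permissible centre at `x`. [cite: CossartPiltant2019, Remark 3.2 (p. 41)] -/
theorem cp19Remark32_isPermissibleCentre_curve (p : ℕ) :
    IsPermissibleCentre p cp19Remark32Curve (cp19Remark32 p : CState (Fin 4) K) :=
  Or.inr (cp19Remark32_isSecondKind_curve p)

/-! ### 3. The blow-up of `𝒴₁`, point `x'` = origin of the `u₄`-chart -/

/-- The chart law `d ↦ d'`, `d'₃ = ord_{S₁}(d) − p`, fixes `d_A` (`(p + 1) − p = 1 = (d_A)₃`):
`u₄u₁^p ↦ u'₄u'₁^p`. [cite: CossartPiltant2019, Remark 3.2 (p. 41)] -/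
theorem chartExponent_centre_cp19Remark32ExpA (p : ℕ) :
    chartExponent p cp19Remark32Centre 3 (Finsupp.single 3 1 + Finsupp.single 0 p) =
      Finsupp.single 3 1 + Finsupp.single 0 p := by
  unfold chartExponent
  rw [degIn_centre_cp19Remark32ExpA, Nat.add_sub_cancel_left]
  ext i
  rw [Finsupp.update_apply]
  split_ifs with h
  · rw [h, cp19Remark32ExpA_three]
  · rfl

/-- The chart law fixes `d_B` (`p − p = 0 = (d_B)₃`): `u₃u₂^p ↦ u₃u'₂^p`.
[cite: CossartPiltant2019, Remark 3.2 (p. 41)] -/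
theorem chartExponent_centre_cp19Remark32ExpB (p : ℕ) :
    chartExponent p cp19Remark32Centre 3 (Finsupp.single 2 1 + Finsupp.single 1 p) =
      Finsupp.single 2 1 + Finsupp.single 1 p := by
  unfold chartExponent
  rw [degIn_centre_cp19Remark32ExpB, Nat.sub_self]
  ext i
  rw [Finsupp.update_apply]
  split_ifs with h
  · rw [h, cp19Remark32ExpB_three]
  · rfl

/-- The chart transform of `F` in the `u₄`-chart of the blow-up of `𝒴₁` is `F` again
("`h' = Z'^p + u'₄u'₁^p + u₃u'₂^p`"). [cite: CossartPiltant2019, Remark 3.2 (p. 41)] -/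
theorem cp19Remark32_chartTransform (p : ℕ) :
    chartTransform p cp19Remark32Centre 3 (cp19Remark32 p : CState (Fin 4) K).F =
      (cp19Remark32 p : CState (Fin 4) K).F := by
  rw [cp19Remark32_F, chartTransform_binomial p cp19Remark32Centre 3 (cp19Remark32ExpA_ne_ExpB p),
    chartExponent_centre_cp19Remark32ExpA, chartExponent_centre_cp19Remark32ExpB]

/-- At the origin `x'` of the `u₄`-chart the (uncleaned) transform is `F`.
[cite: CossartPiltant2019, Remark 3.2 (p. 41)] -/
theorem cp19Remark32_pointTransform (p : ℕ) :
    pointTransform p cp19Remark32Centre 3 (0 : Fin 4 → K) (cp19Remark32 p) =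
      (cp19Remark32 p : CState (Fin 4) K).F := by
  unfold pointTransform
  rw [PointBlowup.translate_zero, cp19Remark32_chartTransform]

/-- `x'` is again a point of multiplicity `p` of `𝒳'` (every monomial of `F` has degree `p + 1 ≥ p`).
[cite: CossartPiltant2019, Remark 3.2 (p. 41)] -/
theorem cp19Remark32_isEquimultiplePoint (p : ℕ) :
    IsEquimultiplePoint p cp19Remark32Centre 3 (0 : Fin 4 → K) (cp19Remark32 p) := by
  intro d _ hdeg
  rw [cp19Remark32_pointTransform]
  by_contra hne
  have hd : d ∈ (cp19Remark32 p : CState (Fin 4) K).F.support := MvPolynomial.mem_support_iff.mpr hne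
  rw [cp19Remark32_support, Finset.mem_insert, Finset.mem_singleton] at hd
  rcases hd with rfl | rfl
  · rw [degree_cp19Remark32ExpA] at hdeg; omega
  · rw [degree_cp19Remark32ExpB] at hdeg; omega

/-- `d_A` is not a `p`-th power exponent (`(d_A)₃ = 1`, `p > 1`). [cite: CossartPiltant2019, Remark 3.2 (p. 41)] -/
theorem not_isPthPowerExponent_cp19Remark32ExpA {p : ℕ} (hp : 1 < p) :
    ¬ IsPthPowerExponent p (Finsupp.single 3 1 + Finsupp.single 0 p : Fin 4 →₀ ℕ) := by
  rw [isPthPowerExponent_iff]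
  intro h
  have h3 := h 3
  rw [cp19Remark32ExpA_three] at h3
  have := Nat.dvd_one.mp h3
  omega

/-- `d_B` is not a `p`-th power exponent (`(d_B)₂ = 1`, `p > 1`). [cite: CossartPiltant2019, Remark 3.2 (p. 41)] -/
theorem not_isPthPowerExponent_cp19Remark32ExpB {p : ℕ} (hp : 1 < p) :
    ¬ IsPthPowerExponent p (Finsupp.single 2 1 + Finsupp.single 1 p : Fin 4 →₀ ℕ) := by
  rw [isPthPowerExponent_iff]
  intro h
  have h2 := h 2
  rw [cp19Remark32ExpB_two] at h2
  have := Nat.dvd_one.mp h2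
  omega

section Step

variable [DecidableEq K]

/-- "`h' = Z'^p + u'₄u'₁^p + u₃u'₂^p`": after the blow-up of `𝒴₁`, at `x'`, the cleaned residual
polynomial is `F` again (no `p`-th powers to delete, `p > 1`). [cite: CossartPiltant2019, Remark 3.2 (p. 41)] -/
theorem cp19Remark32_step_F {p : ℕ} (hp : 1 < p) :
    (step p cp19Remark32Centre 3 (0 : Fin 4 → K) (cp19Remark32 p)).F =
      (cp19Remark32 p : CState (Fin 4) K).F := by
  show deletePthPowers p (pointTransform p cp19Remark32Centre 3 (0 : Fin 4 → K) (cp19Remark32 p)) = _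
  rw [cp19Remark32_pointTransform, cp19Remark32_F]
  exact PointBlowup.deletePthPowers_binomial p (not_isPthPowerExponent_cp19Remark32ExpA hp)
    (not_isPthPowerExponent_cp19Remark32ExpB hp)

/-- "`E' = div(u'₁u'₂u₃u'₄)`": after the blow-up of `𝒴₁` all four variables are exceptional at `x'`
(the new component `u'₄ = 0` and the strict transforms of `u₁, u₂, u₃`). [cite: CossartPiltant2019, Remark 3.2 (p. 41)] -/
theorem cp19Remark32_step_exc (p : ℕ) :
    (step p cp19Remark32Centre 3 (0 : Fin 4 → K) (cp19Remark32 p)).exc = Finset.univ := by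
  show insert (3 : Fin 4) ((({0, 1, 2} : Finset (Fin 4))).filter fun i => (0 : Fin 4 → K) i = 0) =
    Finset.univ
  have hfilter : ((({0, 1, 2} : Finset (Fin 4))).filter fun i => (0 : Fin 4 → K) i = 0) = {0, 1, 2} :=
    Finset.filter_true_of_mem fun i _ => rfl
  rw [hfilter]
  decide

/-- `ε(x') = p + 1`. [cite: CossartPiltant2019, Remark 3.2 (p. 41)] -/
theorem cp19Remark32_step_epsilon {p : ℕ} (hp : 1 < p) :
    (step p cp19Remark32Centre 3 (0 : Fin 4 → K) (cp19Remark32 p)).epsilon = (p + 1 : ℕ) := by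
  rw [CState.epsilon_eq, cp19Remark32_step_F hp, Finset.sum_eq_zero (fun j _ => cp19Remark32_bigH p j),
    tsub_zero, cp19Remark32_ordZero]

/-- `V(F'_{p,Z'}, E', m_{S'}) = 0`: there is no variable off `E'`. [cite: CossartPiltant2019, Remark 3.2 (p. 41)] -/
theorem cp19Remark32_step_not_vNonzero (p : ℕ) :
    ¬ PointBlowup.VNonzero (step p cp19Remark32Centre 3 (0 : Fin 4 → K) (cp19Remark32 p)).exc
        (step p cp19Remark32Centre 3 (0 : Fin 4 → K) (cp19Remark32 p)).F := by
  rintro ⟨j, hj, -⟩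
  rw [cp19Remark32_step_exc] at hj
  exact hj (Finset.mem_univ j)

/-- `ω(x') = p + 1` (`ω = ε` since `V = 0`). [cite: CossartPiltant2019, Remark 3.2 (p. 41)] -/
theorem cp19Remark32_step_omega {p : ℕ} (hp : 1 < p) :
    (step p cp19Remark32Centre 3 (0 : Fin 4 → K) (cp19Remark32 p)).omega = (p + 1 : ℕ) := by
  rw [CState.omega_eq_of_not_vNonzero _ (cp19Remark32_step_not_vNonzero p),
    cp19Remark32_step_epsilon hp]

/-- "`ε(x') = ω(x')`". [cite: CossartPiltant2019, Remark 3.2 (p. 41)] -/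
theorem cp19Remark32_step_epsilon_eq_omega {p : ℕ} (hp : 1 < p) :
    (step p cp19Remark32Centre 3 (0 : Fin 4 → K) (cp19Remark32 p)).epsilon =
      (step p cp19Remark32Centre 3 (0 : Fin 4 → K) (cp19Remark32 p)).omega := by
  rw [cp19Remark32_step_epsilon hp, cp19Remark32_step_omega hp]

/-- "`ω(x') = p + 1 > ω(x)`": `ω` INCREASES at `x'` under the blow-up of the Hironaka-permissible
centre `𝒴₁` satisfying (i) and (ii) but not (iii). [cite: CossartPiltant2019, Remark 3.2 (p. 41)] -/
theorem cp19Remark32_omegaIncreases {p : ℕ} (hp : 1 < p) :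
    OmegaIncreases p cp19Remark32Centre 3 (0 : Fin 4 → K) (cp19Remark32 p) := by
  unfold OmegaIncreases
  rw [cp19Remark32_omega, cp19Remark32_step_omega hp]
  exact_mod_cast Nat.lt_succ_self p

/-- `ε` does NOT increase at `x'` (`ε(x') = p + 1 = ε(x)`): the increase of `ω` comes from the
boundary (`V ≠ 0` before, `V = 0` after), not from `ε`. [cite: CossartPiltant2019, Remark 3.2 (p. 41)] -/
theorem cp19Remark32_not_epsilonIncreases {p : ℕ} (hp : 1 < p) :
    ¬ EpsilonIncreases p cp19Remark32Centre 3 (0 : Fin 4 → K) (cp19Remark32 p) := by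
  unfold EpsilonIncreases
  rw [cp19Remark32_epsilon, cp19Remark32_step_epsilon hp]
  exact lt_irrefl _

/-- `ε(y'₀) = p` for the transform `𝒴'₀ = V(Z',u'₁,u'₂) = C_{S₀}` at `x'`.
[cite: CossartPiltant2019, Remark 3.2 (p. 41)] -/
theorem cp19Remark32_epsilonAlong_curve_step {p : ℕ} (hp : 1 < p) :
    epsilonAlong cp19Remark32Curve (step p cp19Remark32Centre 3 (0 : Fin 4 → K) (cp19Remark32 p)) = p := by
  unfold epsilonAlong
  rw [cp19Remark32_step_F hp, Finset.sum_eq_zero (fun j _ => cp19Remark32_bigH p j), tsub_zero,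
    cp19Remark32_ordAlong_curve]

/-- "`𝒴'₀` is not permissible at `x'` since `ε(y₀) = p < ε(x')`" (not of the first kind; and not of
the second kind either, every variable being exceptional at `x'`). [cite: CossartPiltant2019, Remark 3.2 (p. 41)] -/
theorem cp19Remark32_not_isPermissibleCentre_curve_step {p : ℕ} (hp : 1 < p) :
    ¬ IsPermissibleCentre p cp19Remark32Curve
        (step p cp19Remark32Centre 3 (0 : Fin 4 → K) (cp19Remark32 p)) := by
  rintro (⟨-, h⟩ | ⟨-, -, ⟨d, -, -, t, -, ht, -, -⟩⟩)
  · rw [cp19Remark32_epsilonAlong_curve_step hp, cp19Remark32_step_epsilon hp] at h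
    have := ENat.coe_inj.mp h
    omega
  · rw [cp19Remark32_step_exc] at ht
    exact ht (Finset.mem_univ t)

/-! ### 4. Packaging: the hypothesis (iii) of Theorem 3.6 cannot be dropped -/

/-- **[CP19, Remark 3.2] in the model.**  There is a `C_S`-step of the walk — the blow-up of
`𝒴₁ = V(Z,u₁,u₂,u₄)` for `h = Z^p + u₄u₁^p + u₃u₂^p`, `E = div(u₁u₂u₃)`, read at the origin of the
`u₄`-chart — at which: the point lies over `x` on the new exceptional divisor, the centre is
Hironaka-permissible w.r.t. `E` and satisfies clause (ii) `ε(y) + 1 = ε(x)` of Def. 3.2, the new point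
is again `p`-fold, `0 < ω(x) < ∞`, and yet `ω` increases (while `ε` does not).  So in the test
predicate `NoOmegaIncreaseAtCentre` the hypothesis `IsPermissibleCentre` cannot be weakened to
"(i) and (ii)": clause (iii) is needed. [cite: CossartPiltant2019, Remark 3.2 (p. 41)] -/
theorem cp19Remark32_sharpness {p : ℕ} (hp : 1 < p) :
    ∃ (S : Finset (Fin 4)) (j : Fin 4) (b : Fin 4 → K) (s : CState (Fin 4) K),
      j ∈ S ∧ b j = 0 ∧ (∀ i, i ∉ S → b i = 0) ∧ IsHironakaPermissible p S s ∧
        epsilonAlong S s + 1 = s.epsilon ∧ ¬ HasTransverseLinear S s ∧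
        IsEquimultiplePoint p S j b s ∧ 0 < s.omega ∧ s.omega ≠ ⊤ ∧
        OmegaIncreases p S j b s ∧ ¬ EpsilonIncreases p S j b s :=
  ⟨cp19Remark32Centre, 3, 0, cp19Remark32 p, by decide, rfl, fun _ _ => rfl,
    cp19Remark32_isHironakaPermissible_centre p, cp19Remark32_epsilonAlong_centre_add_one p,
    cp19Remark32_not_hasTransverseLinear_centre p, cp19Remark32_isEquimultiplePoint p,
    cp19Remark32_omega_pos (by omega), cp19Remark32_omega_ne_top p, cp19Remark32_omegaIncreases hp,
    cp19Remark32_not_epsilonIncreases hp⟩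

/-- The test predicate `NoOmegaIncreaseAtCentre` (Thm. 3.6 read at one `C_S`-step) is satisfied at the
edge of Remark 3.2 — vacuously, because its hypothesis `IsPermissibleCentre` fails there (the atlas
files this edge under "centre not permissible", not as a violation). [cite: CossartPiltant2019, Remark 3.2 (p. 41)] -/
theorem cp19Remark32_noOmegaIncreaseAtCentre (p : ℕ) :
    NoOmegaIncreaseAtCentre p cp19Remark32Centre 3 (0 : Fin 4 → K) (cp19Remark32 p) :=
  fun _ _ _ h _ _ _ _ => cp19Remark32_not_isPermissibleCentre_centre p h

end Step

end State

end CentreBlowup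

end Literature.AlgebraicGeometry.Resolution

end
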